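import Summits.HodgeConjecture.CorCM.CyclicCompositeCMTypes
import Summits.HodgeConjecture.CorCM.CyclicTimesPrimeCMTypesField
import Summits.HodgeConjecture.CorCM.Model.CMAbelianVarietyRealisedHolds
import Literature.AlgebraicGeometry.ComplexMultiplication.ShimuraIsogenousPowerOfRiemann
import HarnessLib

/-!
# CM fields with CYCLIC Galois group: every primitive CM type is nondegenerate ⟺ the odd part of the degree is
# `1` or a prime — and otherwise simple CM abelian varieties with exceptional Hodge classes

COR-CM (cell `pub-hodgecm2`), binder seat b04 (gen 12), count-neutral, claim CYCLIC-CLASSIF; number-field dress of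
`CorCM/CyclicCompositeCMTypes` (group level) closing the cyclic chapter opened by gen 11
(`CorCM/CyclicTwoPowerCMTypes`, `CorCM/CyclicTimesPrimeCMTypes(.Field)`).  KERNEL ONLY: theorems; no definition, no
named fact, no `sorry`.

Let `K` be a CM field, normal over `ℚ`, whose Galois group is CYCLIC of order `[K:ℚ] = 2^{a+1} m`, `m` odd.

* `exists_isPrimitive_not_isNondegenerate_of_isCyclic` — if `m` has a divisor `1 < l < m` (i.e. `m` is COMPOSITE)
  then `K` carries a CM type `Φ` which is PRIMITIVE (Shimura §8.2 Prop. 26, `IsPrimitive`, at every base embedding)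
  and DEGENERATE (`¬ IsNondegenerate Φ`: Kubota rank `< 2^a m + 1`): the inflated block type of
  `CyclicComposite.exists_primitive_degenerate`, carried to `Hom(K, ℂ)` along Shimura's indexing `σ_g = φ₀ ∘ g⁻¹`
  (`exists_cmType_of_isCMTypeWith_gal`, the converse reading of `Pohlmann1968.isCMTypeWith_gal`);
* `isSimple_and_exists_exceptional_of_isCyclic` / `exists_simple_exceptional_realisation_of_isCyclic` — every
  realisation `(A, ι, θ)` of this `Φ` is a SIMPLE abelian variety of dimension `2^a m` some power of which carries a
  rational `(k,k)`-class OUTSIDE `Dᵏ ⊗ ℂ` (Hazama's converse, tree `exists_exceptional_pow_of_not_isNondegenerate`),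
  and such realisations EXIST (tree theorem `CorCM.cmAbelianVarietyRealised_holds`, Shimura §6.2 Thm. 3) —
  unconditionally;
* **`forall_isPrimitive_isNondegenerate_iff_of_isCyclic` — THE CLASSIFICATION**: every primitive CM type of `K` is
  nondegenerate ⟺ `m = 1 ∨ m` prime (⇐: gen 11, `CyclicTwoPower.isNondegenerate_of_isCyclic` and
  `CyclicTwoPower.isNondegenerate_of_isPrimitive_of_isCyclic`; ⇒: the first bullet); equivalently
  (`forall_isSimple_hodgeClassSpan_eq_iff_of_isCyclic`) `Bᵏ(Aⁿ) ⊗ ℂ = Dᵏ(Aⁿ) ⊗ ℂ` on all powers of ALL simple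
  abelian varieties with CM by `K` ⟺ `m = 1 ∨ m` prime;
* §3: `ℚ(ζ_p)` for primes `p` with `p − 1 = 2^{a+1} m`: the dichotomy by `m` (`…_of_prime`), e.g. `ℚ(ζ₁₉)`
  (`18 = 2·9`, Serre's example in Gordon 9.4.2 is ONE such type), `ℚ(ζ₃₇)` (`36 = 2²·9`, a non-split case not
  covered by Dodson's `⟨ρ⟩ × ℤ_n`), versus `ℚ(ζ₁₃)`, `ℚ(ζ₉₇)` of gen 11.

For `a = 0` the existence statement is Dodson's Theorem 3.2.1 [Dodson1984] on `Gal = ⟨ρ⟩ × ℤ_m` (tree: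
`ComplexMultiplication/DegenerateCMTypesCompositeDimension.lean`, lit-deligne-3, with the exact rank `n − l + 2`); the
present files add the non-split `2`-part and the equivalence.

## References

* [Dodson1984] B. Dodson, *The structure of Galois groups of CM-fields*, Trans. AMS 283 (1984), §3.2.1.
* [Kubota1965] T. Kubota, *On the field extension by complex multiplication*, Trans. AMS 118 (1965), §2, §4 Lemma 2.
* [Shimura1998] G. Shimura, *Abelian Varieties with Complex Multiplication and Modular Functions*, §6.2 Thm. 3,
  §8.1, §8.2 Prop. 26, §18.2 Lemma.
* [Gordon1999HodgeAVSurvey] B. B. Gordon, *A survey of the Hodge conjecture for abelian varieties*, Thm. 6.4, §9.4.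
* [Washington1997] L. C. Washington, *Introduction to Cyclotomic Fields*, Thm. 2.5.
-/

noncomputable section

open CategoryTheory CategoryTheory.Limits NumberField

namespace Summit.HodgeConjecture.CorCM.CyclicComposite

open Literature.NumberTheory.ComplexMultiplication
open Literature.AlgebraicGeometry.Motives (AbelianVariety CMType)
open Literature.AlgebraicGeometry.HodgeTheory
open Literature.AlgebraicGeometry.ComplexMultiplication (IsCMTypeRealisation isSimple_iff_isPrimitive
  exists_isCMTypeRealisation_of_realised)
open Literature.AlgebraicGeometry.VanGeemen1994 (hodgeClassSpan)
open Literature.Barriers.HodgeConjecture (divisorClassesSpan)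
open Literature.AlgebraicGeometry.Pohlmann1968
open Summit.HodgeConjecture.CorCM.CyclicTwoPower (involution_eq_pow exists_conj_gal isNondegenerate_of_isCyclic
  isNondegenerate_of_isPrimitive_of_isCyclic cm_normal_cyclic_finrank_of_prime)

/-! ### §1 From a CM type on the Galois group to a CM type on `Hom(K, ℂ)` -/

section Field

variable {K : Type} [Field K] [NumberField K] [IsCMField K] [Normal ℚ K]

omit [IsCMField K] in
/-- **A CM type read on `Gal(K/ℚ)` comes from a CM type of `K`** (converse reading of
`Pohlmann1968.isCMTypeWith_gal`): for `K/ℚ` normal with abelian Galois group, `ρ ∈ Gal(K/ℚ)` with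
`φ₀ ∘ ρ = conj ∘ φ₀`, and `S ⊆ Gal(K/ℚ)` containing exactly one of `g, ρg` for every `g`, the set
`Φ = {σ_g = φ₀ ∘ g⁻¹ : g ∈ S}` is a CM type of `K` with `{g | σ_g ∈ Φ} = S`. [cite: Shimura1998, §8.1, §18.2 Lemma (i)] -/
theorem exists_cmType_of_isCMTypeWith_gal (hcomm : ∀ g h : K ≃ₐ[ℚ] K, g * h = h * g) (φ₀ : K →+* ℂ)
    (ρ : K ≃ₐ[ℚ] K) (hρ : ∀ x, φ₀ (ρ x) = starRingEnd ℂ (φ₀ x)) (S : Finset (K ≃ₐ[ℚ] K))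
    (hS : IsCMTypeWith ρ (S : Set (K ≃ₐ[ℚ] K))) :
    ∃ Φ : CMType K, ∀ g : K ≃ₐ[ℚ] K, embOf φ₀ g ∈ Φ.1 ↔ g ∈ S := by
  classical
  let e : (K ≃ₐ[ℚ] K) ≃ (K →+* ℂ) := Equiv.ofBijective (embOf φ₀) (embOf_bijective φ₀)
  have he : ∀ g, e g = embOf φ₀ g := fun g => rfl
  -- `ρ² = 1`, `conj ∘ σ_g = σ_{ρg}`
  have hρρ : ρ * ρ = 1 := by
    have h := hS.invol 1
    rwa [smul_eq_mul, smul_eq_mul, mul_one] at h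
  have hρinv : ρ⁻¹ = ρ := by rw [inv_eq_iff_mul_eq_one, hρρ]
  have hconj : ∀ g : K ≃ₐ[ℚ] K, ComplexEmbedding.conjugate (embOf φ₀ g) = embOf φ₀ (ρ * g) := by
    intro g
    have h := smul_embOf_of_comp φ₀ (τ := starRingAut) (δ := ρ) (fun x => (hρ x).symm) g
    rw [conj_smul_eq_conjugate] at h
    rw [h, hρinv, hcomm]
  refine ⟨⟨{φ | e.symm φ ∈ S}, fun φ => ?_⟩, fun g => ?_⟩
  · obtain ⟨g, rfl⟩ := e.surjective φ
    rw [Set.mem_setOf_eq, Set.mem_setOf_eq, he, hconj, ← he g, ← he (ρ * g), Equiv.symm_apply_apply,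
      Equiv.symm_apply_apply]
    have h := hS.mem_iff g
    rwa [Finset.mem_coe, smul_eq_mul, Finset.mem_coe] at h
  · change e.symm (embOf φ₀ g) ∈ S ↔ g ∈ S
    rw [← he, Equiv.symm_apply_apply]

omit [Normal ℚ K] in
/-- Complex conjugation `ρ ∈ Gal(K/ℚ)` of a CM field is not the identity (no embedding of `K` is real).
[cite: Shimura1998, §18.2 Lemma (i)] -/
theorem conj_gal_ne_one (φ₀ : K →+* ℂ) (ρ : K ≃ₐ[ℚ] K) (hρ : ∀ x, φ₀ (ρ x) = starRingEnd ℂ (φ₀ x)) : ρ ≠ 1 := by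
  intro h
  refine IsTotallyComplex.complexEmbedding_not_isReal φ₀ (ComplexEmbedding.isReal_iff.2 (RingHom.ext fun x => ?_))
  rw [ComplexEmbedding.conjugate_coe_eq, ← hρ, h, AlgEquiv.one_apply]

/-! ### §2 Cyclic Galois group of order `2^{a+1} m`, `m` odd -/

/-- **`m` COMPOSITE ⟹ a PRIMITIVE DEGENERATE CM type.**  For `K` CM, normal over `ℚ`, with cyclic Galois group of
order `[K:ℚ] = 2^{a+1} m`, `m` odd with a divisor `1 < l < m`: there is a CM type `Φ` of `K`, primitive at every base
embedding (Shimura §8.2 Prop. 26) and of Kubota rank `< 2^a m + 1`.  (Split case `a = 0`: Dodson 1984 Thm. 3.2.1.)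
[cite: Dodson1984, §3.2.1] [cite: Kubota1965, §4 Lemma 2] [cite: Shimura1998, §8.2 Prop. 26] -/
theorem exists_isPrimitive_not_isNondegenerate_of_isCyclic (hcyc : IsCyclic (K ≃ₐ[ℚ] K)) {a m l : ℕ}
    (hm : Odd m) (hlm : l ∣ m) (h2l : 2 ≤ l) (hl : l < m) (hK : Module.finrank ℚ K = 2 ^ (a + 1) * m) :
    ∃ Φ : CMType K, (∀ φ₁ : K →+* ℂ, IsPrimitive (ℂ ≃+* ℂ) Φ.1 φ₁) ∧ ¬IsNondegenerate Φ := by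
  classical
  obtain ⟨γ, hγgen⟩ := hcyc.exists_generator
  have hgen : ∀ x : K ≃ₐ[ℚ] K, x ∈ Submonoid.powers γ := fun x => mem_powers_iff_mem_zpowers.2 (hγgen x)
  have hcomm : ∀ g h : K ≃ₐ[ℚ] K, g * h = h * g := fun g h => by
    obtain ⟨i, rfl⟩ := (Submonoid.mem_powers_iff _ _).1 (hgen g)
    obtain ⟨j, rfl⟩ := (Submonoid.mem_powers_iff _ _).1 (hgen h)
    rw [← pow_add, ← pow_add, add_comm]
  obtain ⟨φ₀⟩ := (inferInstance : Nonempty (K →+* ℂ))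
  obtain ⟨ρ, hρ⟩ := exists_conj_gal (K := K)
  have hcard : Fintype.card (K ≃ₐ[ℚ] K) = 2 ^ (a + 1) * m := by
    rw [Fintype.card_congr (Equiv.ofBijective (embOf φ₀) (embOf_bijective φ₀)), NumberField.Embeddings.card, hK]
  have hγ : orderOf γ = 2 ^ (a + 1) * m := by
    rw [orderOf_eq_card_of_forall_mem_zpowers hγgen, Nat.card_eq_fintype_card, hcard]
  -- `ρ = γ^{2^a m}`: the only involution of the cyclic group
  have hρρ : ρ * ρ = 1 := by
    apply AlgEquiv.ext
    intro x
    apply φ₀.injective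
    rw [AlgEquiv.mul_apply, hρ φ₀, hρ φ₀, starRingEnd_self_apply, AlgEquiv.one_apply]
  have hρeq : ρ = γ ^ (2 ^ a * m) :=
    involution_eq_pow (by rw [hγ, pow_succ]; ring) hgen (conj_gal_ne_one φ₀ ρ (hρ φ₀)) hρρ
  -- the inflated block type on `Gal(K/ℚ)` and its transport
  obtain ⟨S, hScm, ⟨χ, hχρ, hχ0⟩, hsep⟩ := exists_primitive_degenerate hγ hgen hm hlm h2l hl
  rw [← hρeq] at hScm hχρ
  obtain ⟨Φ, hΦ⟩ := exists_cmType_of_isCMTypeWith_gal hcomm φ₀ ρ (hρ φ₀) S hScm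
  refine ⟨Φ, fun φ₁ => ?_, ?_⟩
  · -- primitive: the translates of `S` separate points, and `Aut(ℂ)` reaches every translation
    haveI := isPretransitive_ringEquiv_complex (K := K)
    refine (isPrimitive_iff_forall_eq Φ.1 φ₁).2 fun x y hxy => ?_
    obtain ⟨gx, rfl⟩ := (embOf_bijective φ₀).2 x
    obtain ⟨gy, rfl⟩ := (embOf_bijective φ₀).2 y
    rw [hsep gx gy fun g => ?_]
    obtain ⟨τ, hτ⟩ := exists_ringEquiv_comp_eq_algEquiv φ₀ g⁻¹
    have h := hxy τ
    rwa [smul_embOf_of_comp φ₀ hτ, smul_embOf_of_comp φ₀ hτ, inv_inv, hΦ, hΦ, hcomm gx g, hcomm gy g] at h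
  · -- degenerate: an odd character vanishes on `{g | σ_g ∈ Φ} = S` (Kubota's Lemma 2)
    rw [isNondegenerate_iff_forall_oddCharacters hcomm Φ φ₀ ρ (hρ φ₀), not_forall]
    refine ⟨χ, fun h => h hχρ ?_⟩
    have hfilter : (Finset.univ.filter fun g : K ≃ₐ[ℚ] K => embOf φ₀ g ∈ Φ.1) = S := by
      ext g
      simp only [Finset.mem_filter, Finset.mem_univ, true_and, hΦ]
    rw [hfilter, hχ0]

/-- … with Kubota rank `< 2^a m + 1`. [cite: Kubota1965, §2 (p. 115)] -/
theorem exists_isPrimitive_cmTypeRank_lt_of_isCyclic (hcyc : IsCyclic (K ≃ₐ[ℚ] K)) {a m l : ℕ} (hm : Odd m)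
    (hlm : l ∣ m) (h2l : 2 ≤ l) (hl : l < m) (hK : Module.finrank ℚ K = 2 ^ (a + 1) * m) :
    ∃ Φ : CMType K, (∀ φ₁ : K →+* ℂ, IsPrimitive (ℂ ≃+* ℂ) Φ.1 φ₁) ∧ cmTypeRank Φ < 2 ^ a * m + 1 := by
  obtain ⟨Φ, hprim, hdeg⟩ := exists_isPrimitive_not_isNondegenerate_of_isCyclic hcyc hm hlm h2l hl hK
  have h2 : Module.finrank ℚ K / 2 = 2 ^ a * m := by
    rw [hK, pow_succ, mul_assoc, mul_comm 2, ← mul_assoc, Nat.mul_div_cancel _ two_pos]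
  refine ⟨Φ, hprim, lt_of_le_of_ne (h2 ▸ cmTypeRank_le Φ) fun h => hdeg ?_⟩
  rw [isNondegenerate_iff, h2, h]

variable {Φ : CMType K} {A : AbelianVariety ℂ} {ι : 𝓞 K →+* End A} {θ : K →+* Module.End ℂ (complexBetti A.X 1)}

omit [Normal ℚ K] in
/-- **Realisations of a primitive degenerate type: SIMPLE, with an exceptional Hodge class on a power** (Shimura
§8.2 Prop. 26; Hazama's converse, Gordon Thm. 6.4): for `Φ` primitive and degenerate and any realisation `(A, ι, θ)`
of `(K; Φ)` on `H¹`, `A` is simple of dimension `[K:ℚ]/2` and some `Aⁿ` carries a rational `(k,k)`-class outside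
`Dᵏ(Aⁿ) ⊗ ℂ`. [cite: Shimura1998, §8.2 Prop. 26] [cite: Gordon1999HodgeAVSurvey, Thm. 6.4] -/
theorem isSimple_and_exists_exceptional_of_isPrimitive (hprim : ∀ φ₁ : K →+* ℂ, IsPrimitive (ℂ ≃+* ℂ) Φ.1 φ₁)
    (hdeg : ¬IsNondegenerate Φ) (hA : IsCMTypeRealisation Φ A ι θ) :
    A.IsSimple ∧ A.dim = Module.finrank ℚ K / 2 ∧
      ∃ n k : ℕ, ∃ c : complexBetti (⨁ fun _ : Fin n => A).X (2 * k), IsRationalClass c ∧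
        IsOfHodgeType (⨁ fun _ : Fin n => A).dim (⨁ fun _ : Fin n => A).X (2 * k) k k c ∧
        c ∉ divisorClassesSpan (⨁ fun _ : Fin n => A).X (⨁ fun _ : Fin n => A).dim k := by
  obtain ⟨φ₀⟩ := (inferInstance : Nonempty (K →+* ℂ))
  exact ⟨(isSimple_iff_isPrimitive hA φ₀).2 (hprim φ₀),
    Literature.AlgebraicGeometry.Motives.schemeDim_eq_holds hA.1,
    exists_exceptional_pow_of_not_isNondegenerate φ₀ (hprim φ₀) hdeg hA⟩

/-- **`m` composite ⟹ simple CM abelian varieties of dimension `2^a m` with exceptional Hodge classes EXIST**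
(unconditionally: realisations by the tree theorem `cmAbelianVarietyRealised_holds`, Shimura §6.2 Thm. 3): for `K`
CM, normal, with cyclic Galois group of order `2^{a+1} m`, `m` odd with a divisor `1 < l < m`, there are a CM type
`Φ` and a realisation `(A, ι, θ)` with `A` SIMPLE, `dim A = 2^a m`, `Φ` DEGENERATE, and a rational `(k,k)`-class on
some `Aⁿ` outside `Dᵏ(Aⁿ) ⊗ ℂ` — the exact complement, for cyclic Galois groups, of gen 11's `Bᵏ(Aⁿ) = Dᵏ(Aⁿ)` for
`m ∈ {1} ∪ primes`. [cite: Dodson1984, §3.2.1] [cite: Shimura1998, §6.2 Thm. 3] [cite: Gordon1999HodgeAVSurvey, Thm. 6.4] -/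
theorem exists_simple_exceptional_realisation_of_isCyclic (hcyc : IsCyclic (K ≃ₐ[ℚ] K)) {a m l : ℕ} (hm : Odd m)
    (hlm : l ∣ m) (h2l : 2 ≤ l) (hl : l < m) (hK : Module.finrank ℚ K = 2 ^ (a + 1) * m) :
    ∃ (Φ : CMType K) (A : AbelianVariety ℂ) (ι : 𝓞 K →+* End A)
      (θ : K →+* Module.End ℂ (complexBetti A.X 1)),
      IsCMTypeRealisation Φ A ι θ ∧ A.IsSimple ∧ A.dim = 2 ^ a * m ∧ ¬IsNondegenerate Φ ∧
      ∃ n k : ℕ, ∃ c : complexBetti (⨁ fun _ : Fin n => A).X (2 * k), IsRationalClass c ∧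
        IsOfHodgeType (⨁ fun _ : Fin n => A).dim (⨁ fun _ : Fin n => A).X (2 * k) k k c ∧
        c ∉ divisorClassesSpan (⨁ fun _ : Fin n => A).X (⨁ fun _ : Fin n => A).dim k := by
  obtain ⟨Φ, hprim, hdeg⟩ := exists_isPrimitive_not_isNondegenerate_of_isCyclic hcyc hm hlm h2l hl hK
  obtain ⟨A, ι, θ, hA⟩ := exists_isCMTypeRealisation_of_realised cmAbelianVarietyRealised_holds K Φ
  obtain ⟨hsimple, hdim, hexc⟩ := isSimple_and_exists_exceptional_of_isPrimitive hprim hdeg hA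
  have h2 : Module.finrank ℚ K / 2 = 2 ^ a * m := by
    rw [hK, pow_succ, mul_assoc, mul_comm 2, ← mul_assoc, Nat.mul_div_cancel _ two_pos]
  exact ⟨Φ, A, ι, θ, hA, hsimple, hdim.trans h2, hdeg, hexc⟩

/-- An odd prime is not `2`. [folklore] -/
private theorem ne_two_of_odd {m : ℕ} (hm : Odd m) : m ≠ 2 := by
  obtain ⟨k, rfl⟩ := hm
  omega

/-- **THE CLASSIFICATION FOR CYCLIC GALOIS GROUPS.**  For `K` CM, normal over `ℚ`, with cyclic Galois group of
order `[K:ℚ] = 2^{a+1} m`, `m` odd: every PRIMITIVE CM type of `K` is NONDEGENERATE if and only if `m = 1` or `m` is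
prime.  (⇐: `CyclicTwoPower.isNondegenerate_of_isCyclic` (`m = 1`, all types) and
`CyclicTwoPower.isNondegenerate_of_isPrimitive_of_isCyclic` (`m` an odd prime); ⇒: the inflated block type for a
divisor `1 < l < m`.) [cite: Kubota1965, §4 Lemma 2] [cite: Dodson1984, §3.2.1] [cite: Shimura1998, §8.2 Prop. 26] -/
theorem forall_isPrimitive_isNondegenerate_iff_of_isCyclic (hcyc : IsCyclic (K ≃ₐ[ℚ] K)) {a m : ℕ} (hm : Odd m)
    (hK : Module.finrank ℚ K = 2 ^ (a + 1) * m) :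
    (∀ (Φ : CMType K) (φ₀ : K →+* ℂ), IsPrimitive (ℂ ≃+* ℂ) Φ.1 φ₀ → IsNondegenerate Φ) ↔ (m = 1 ∨ m.Prime) := by
  constructor
  · intro h
    by_contra hnot
    rw [not_or] at hnot
    have h2m : 2 ≤ m := by
      obtain ⟨k, hk⟩ := hm
      omega
    obtain ⟨l, hlm, h2l, hl⟩ := (Nat.not_prime_iff_exists_dvd_lt h2m).1 hnot.2
    obtain ⟨Φ, hprim, hdeg⟩ := exists_isPrimitive_not_isNondegenerate_of_isCyclic hcyc hm hlm h2l hl hK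
    obtain ⟨φ₀⟩ := (inferInstance : Nonempty (K →+* ℂ))
    exact hdeg (h Φ φ₀ (hprim φ₀))
  · rintro (rfl | hp) Φ φ₀ hprim
    · exact isNondegenerate_of_isCyclic hcyc (k := a) (by rw [hK, mul_one]) Φ
    · exact isNondegenerate_of_isPrimitive_of_isCyclic hcyc hp (ne_two_of_odd hm) hK Φ φ₀ hprim

/-- **The same classification on abelian varieties** (Hazama's criterion, Gordon Thm. 6.4, realisations simple ⟺
type primitive, Shimura §8.2 Prop. 26): `Bᵏ(Aⁿ) ⊗ ℂ = Dᵏ(Aⁿ) ⊗ ℂ` for every power of EVERY SIMPLE abelian variety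
`(A, ι, θ)` with CM by `K` (any CM type) ⟺ `m = 1 ∨ m` prime. [cite: Gordon1999HodgeAVSurvey, Thm. 6.4]
[cite: Shimura1998, §6.2 Thm. 3, §8.2 Prop. 26] -/
theorem forall_isSimple_hodgeClassSpan_eq_iff_of_isCyclic (hcyc : IsCyclic (K ≃ₐ[ℚ] K)) {a m : ℕ} (hm : Odd m)
    (hK : Module.finrank ℚ K = 2 ^ (a + 1) * m) :
    (∀ (Φ : CMType K) (A : AbelianVariety ℂ) (ι : 𝓞 K →+* End A) (θ : K →+* Module.End ℂ (complexBetti A.X 1)),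
      IsCMTypeRealisation Φ A ι θ → A.IsSimple → ∀ n k : ℕ,
        hodgeClassSpan (⨁ fun _ : Fin n => A).dim (⨁ fun _ : Fin n => A).X k =
          divisorClassesSpan (⨁ fun _ : Fin n => A).X (⨁ fun _ : Fin n => A).dim k) ↔ (m = 1 ∨ m.Prime) := by
  rw [← forall_isPrimitive_isNondegenerate_iff_of_isCyclic hcyc hm hK]
  constructor
  · intro h Φ φ₀ hprim
    obtain ⟨A, ι, θ, hA⟩ := exists_isCMTypeRealisation_of_realised cmAbelianVarietyRealised_holds K Φ
    exact (isNondegenerate_iff_forall_pow_hodgeClassSpan_eq φ₀ hprim hA).2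
      (h Φ A ι θ hA ((isSimple_iff_isPrimitive hA φ₀).2 hprim))
  · intro h Φ A ι θ hA hsimple n k
    obtain ⟨φ₀⟩ := (inferInstance : Nonempty (K →+* ℂ))
    exact (h Φ φ₀ ((isSimple_iff_isPrimitive hA φ₀).1 hsimple)).hodgeClassSpan_pow_eq_divisorClassesSpan hA n k

end Field

/-! ### §3 `ℚ(ζ_p)`, `p` prime, `p − 1 = 2^{a+1} m` -/

section Prime

variable {L : Type} [Field L] [NumberField L]

/-- `2 < p` for a prime `p` with `p - 1 = 2^{a+1} m`, `m ≥ 1`. [folklore] -/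
private theorem two_lt_of_prime {p a m : ℕ} (hp : p.Prime) (hm : 0 < m) (hpam : p - 1 = 2 ^ (a + 1) * m) :
    2 < p := by
  have h1 : 2 ≤ 2 ^ (a + 1) := by
    rw [pow_succ]; have := Nat.one_le_two_pow (n := a); omega
  have h2 : 2 ≤ 2 ^ (a + 1) * m := le_trans h1 (Nat.le_mul_of_pos_right _ hm)
  have := hp.two_le
  omega

/-- **`ℚ(ζ_p)`, `p − 1 = 2^{a+1} m` with `m` (odd) COMPOSITE: a primitive degenerate CM type, realised by SIMPLE
abelian varieties of dimension `(p−1)/2` with exceptional Hodge classes** — `p = 19, 31, 37, 43, 61, 67, 71, 73, 79, …`.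
[cite: Dodson1984, §3.2.1] [cite: Gordon1999HodgeAVSurvey, §9.4.2] [cite: Washington1997, Thm. 2.5] -/
theorem exists_simple_exceptional_realisation_of_prime {p a m l : ℕ} (hp : p.Prime) (hm : Odd m) (hlm : l ∣ m)
    (h2l : 2 ≤ l) (hl : l < m) (hpam : p - 1 = 2 ^ (a + 1) * m) [IsCyclotomicExtension {p} ℚ L] :
    ∃ (Φ : CMType L) (A : AbelianVariety ℂ) (ι : 𝓞 L →+* End A)
      (θ : L →+* Module.End ℂ (complexBetti A.X 1)),
      IsCMTypeRealisation Φ A ι θ ∧ A.IsSimple ∧ A.dim = 2 ^ a * m ∧ ¬IsNondegenerate Φ ∧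
      ∃ n k : ℕ, ∃ c : complexBetti (⨁ fun _ : Fin n => A).X (2 * k), IsRationalClass c ∧
        IsOfHodgeType (⨁ fun _ : Fin n => A).dim (⨁ fun _ : Fin n => A).X (2 * k) k k c ∧
        c ∉ divisorClassesSpan (⨁ fun _ : Fin n => A).X (⨁ fun _ : Fin n => A).dim k := by
  obtain ⟨hcm, hno, hcyc, hK⟩ := cm_normal_cyclic_finrank_of_prime hp (two_lt_of_prime hp hm.pos hpam) L
  exact exists_simple_exceptional_realisation_of_isCyclic hcyc hm hlm h2l hl (hK.trans hpam)

/-- **`ℚ(ζ_p)`, `p − 1 = 2^{a+1} m`, `m` odd: every primitive CM type is nondegenerate ⟺ `m = 1 ∨ m` prime**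
(`p = 5, 17, 257; 7, 11, 13, 23, 29, 41, 47, 53, 59, 83, 89, 97` versus `19, 31, 37, 43, 61, 67, 71, 73, 79`).
[cite: Kubota1965, §4 Lemma 2] [cite: Dodson1984, §3.2.1] [cite: Washington1997, Thm. 2.5] -/
theorem forall_isPrimitive_isNondegenerate_iff_of_prime {p a m : ℕ} (hp : p.Prime) (hm : Odd m)
    (hpam : p - 1 = 2 ^ (a + 1) * m) [IsCyclotomicExtension {p} ℚ L] :
    (∀ (Φ : CMType L) (φ₀ : L →+* ℂ), IsPrimitive (ℂ ≃+* ℂ) Φ.1 φ₀ → IsNondegenerate Φ) ↔ (m = 1 ∨ m.Prime) := by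
  obtain ⟨hcm, hno, hcyc, hK⟩ := cm_normal_cyclic_finrank_of_prime hp (two_lt_of_prime hp hm.pos hpam) L
  exact forall_isPrimitive_isNondegenerate_iff_of_isCyclic hcyc hm (hK.trans hpam)

/-- **`ℚ(ζ₁₉)` (`18 = 2·9`): NOT every primitive CM type is nondegenerate** — Serre's degenerate type of Gordon
9.4.2 (tree `Pohlmann1968/DegenerateCMTypesRibetLenstraSerre`) is one instance; here from the classification.
[cite: Gordon1999HodgeAVSurvey, §9.4.2] -/
theorem not_forall_isPrimitive_isNondegenerate_nineteen [IsCyclotomicExtension {19} ℚ L] :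
    ¬∀ (Φ : CMType L) (φ₀ : L →+* ℂ), IsPrimitive (ℂ ≃+* ℂ) Φ.1 φ₀ → IsNondegenerate Φ := by
  rw [forall_isPrimitive_isNondegenerate_iff_of_prime (L := L) (p := 19) (a := 0) (m := 9) (by norm_num)
    (by decide) (by norm_num)]
  norm_num

/-- **`ℚ(ζ₃₇)` (`36 = 2²·9`, a NON-SPLIT case): simple CM abelian varieties of dimension `18` with CM by `ℚ(ζ₃₇)`
carrying exceptional Hodge classes exist.** [cite: Dodson1984, §3.2.1] [cite: Shimura1998, §6.2 Thm. 3] -/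
theorem exists_simple_exceptional_realisation_thirtySeven [IsCyclotomicExtension {37} ℚ L] :
    ∃ (Φ : CMType L) (A : AbelianVariety ℂ) (ι : 𝓞 L →+* End A)
      (θ : L →+* Module.End ℂ (complexBetti A.X 1)),
      IsCMTypeRealisation Φ A ι θ ∧ A.IsSimple ∧ A.dim = 18 ∧ ¬IsNondegenerate Φ ∧
      ∃ n k : ℕ, ∃ c : complexBetti (⨁ fun _ : Fin n => A).X (2 * k), IsRationalClass c ∧
        IsOfHodgeType (⨁ fun _ : Fin n => A).dim (⨁ fun _ : Fin n => A).X (2 * k) k k c ∧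
        c ∉ divisorClassesSpan (⨁ fun _ : Fin n => A).X (⨁ fun _ : Fin n => A).dim k :=
  exists_simple_exceptional_realisation_of_prime (L := L) (p := 37) (a := 1) (m := 9) (l := 3) (by norm_num)
    (by decide) (by norm_num) (by norm_num) (by norm_num) (by norm_num)

end Prime

end Summit.HodgeConjecture.CorCM.CyclicComposite

end
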